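import Mathlib
import Literature.MathematicalPhysics.QuantumFieldTheory.Luscher2010.FlowActionSeriesProofs
import Summits.Ventures.LatticeQCDFlow.TrivializingMaps.SlotRepresentation

/-!
HONEST FRAMING: exact (Metropolis-corrected) sampling algorithms for lattice gauge theory; figures of
merit are autocorrelation/cost numbers at stated couplings and volumes; no continuum-physics claim.

# Slot Casimirs — the per-link Casimir operators of a slot representation commute with everything

THEORY-1 §19 (GEN-10), fact (E6).  For a slot system `(σ, lnk, pol)` over links `E`, a basis `B` of `𝔰𝔲(n)`
with `tr(TᵃTᵇ) = -½δᵃᵇ` (`SuBasis`, Literature) and a link `e`, the SLOT CASIMIR is the matrix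
`C^{σ,e} = -∑ₐ T_a^{σ,e} T_a^{σ,e}` on multi-indices `σ → Fin n` (`slotGen` of `SlotRepresentation.lean`).
Proved here, at matrix level and without any harmonic analysis on `SU(n)`:
* §1 real coordinates `X = ∑_c (-2 Re tr(T_c X)) T_c` on `𝔰𝔲(n)` as an `ℝ`-linear functional, the
  antisymmetry of the structure constants it produces, and stability of `𝔰𝔲(n)` under commutators and
  unitary conjugation;
* §2 (E6a/b) `C^{σ,e}` is Hermitian, the Casimirs of different links commute, and `C^{σ,e}` commutes with
  every slot generator `Y^{σ,e'}`, `Y ∈ 𝔰𝔲(n)` (same link: total antisymmetry of `f_{abc}`);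
* §3 (E6c) `C^{σ,e}` commutes with `R_σ(U)` for every unitary configuration `U` — via the conjugation
  formula `R_σ(U) Y^{σ,e} R_σ(U)ᴴ = (U_e Y U_eᴴ)^{σ,e}` and independence of `∑ₐ Φ(T_a)Ψ(T_a)` of the
  orthonormal basis (applied to the conjugated basis `U_e T_a U_eᴴ`).
Consequently the joint eigenprojections of `(C^{σ,e})_e` commute with `R_σ(U)` and with every `T_a^{σ,e}`,
which is what the re-grading step of the Casimir-graded Lüscher recursion uses (THEORY-1 §19.2–19.3;
the grading itself is `CasimirGrading.IsGrading`, instantiated in `GradedLuscherSeries.lean`).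
References: M. Lüscher, Commun. Math. Phys. 293 (2010) 899 [arXiv:0907.5491], App. A (basis, (A.5));
THEORY-1 §19.  Tags: [folklore] = standard Lie-algebra facts, [ours] = venture bookkeeping.
-/

open scoped ComplexConjugate
open Matrix Finset
open Literature.MathematicalPhysics.QuantumFieldTheory
open Literature.MathematicalPhysics.QuantumFieldTheory.Luscher2010
open Summit.Ventures.LatticeQCDFlow.TrivializingMaps.SlotRepresentation

namespace Summit.Ventures.LatticeQCDFlow.TrivializingMaps.SlotCasimir

variable {n : ℕ}

section Coordinates
/-! ## §1. Real coordinates on `𝔰𝔲(n)` and structure constants -/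
variable (B : SuBasis n)

/-- The real coordinate functional `X ↦ -2 Re tr(T_c X)` of the basis vector `T_c`. [folklore] -/
def coordL (c : B.ι) : Matrix (Fin n) (Fin n) ℂ →ₗ[ℝ] ℝ where
  toFun X := -2 * ((B.T c * X).trace).re
  map_add' X Y := by simp only [Matrix.mul_add, Matrix.trace_add, Complex.add_re]; ring
  map_smul' r X := by
    simp only [Matrix.mul_smul, Matrix.trace_smul, Complex.real_smul, Complex.re_ofReal_mul,
      RingHom.id_apply, smul_eq_mul]; ring

/-- Unfolding `coordL`. [folklore] -/
theorem coordL_apply (c : B.ι) (X : Matrix (Fin n) (Fin n) ℂ) :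
    coordL B c X = -2 * ((B.T c * X).trace).re := rfl

/-- The basis vectors are skew-Hermitian. [folklore] -/
theorem skew_T (a : B.ι) : (B.T a)ᴴ = -B.T a := ((mem_suAlgebra_iff _).1 (B.mem a)).1

/-- Dual basis property `coordL_c (T_a) = δ_{ca}`. [folklore] -/
theorem coordL_T (c a : B.ι) : coordL B c (B.T a) = if c = a then 1 else 0 := by
  rw [coordL_apply, B.orth]
  split_ifs <;> norm_num

/-- Real expansion `X = ∑_c coordL_c(X) • T_c` for `X ∈ 𝔰𝔲(n)`. [folklore] -/
theorem eq_sum_coordL_smul {X : Matrix (Fin n) (Fin n) ℂ} (hX : X ∈ suAlgebra n) :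
    X = ∑ c, (coordL B c X) • B.T c := by
  have hXs := ((mem_suAlgebra_iff X).1 hX).1
  conv_lhs => rw [B.eq_sum_trace_smul hX]
  refine Finset.sum_congr rfl fun c _ => ?_
  rw [SUNBakryEmery.trace_mul_eq_re_of_skew (skew_T B c) hXs, ← Complex.coe_smul, coordL_apply]
  congr 1
  push_cast; ring

/-- `𝔰𝔲(n)` is closed under commutators. [folklore] -/
theorem comm_mem_suAlgebra {X Y : Matrix (Fin n) (Fin n) ℂ} (hX : X ∈ suAlgebra n) (hY : Y ∈ suAlgebra n) :
    X * Y - Y * X ∈ suAlgebra n := by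
  rw [mem_suAlgebra_iff] at hX hY ⊢
  refine ⟨?_, ?_⟩
  · rw [conjTranspose_sub, conjTranspose_mul, conjTranspose_mul, hX.1, hY.1, neg_mul_neg, neg_mul_neg,
      neg_sub]
  · rw [trace_sub, trace_mul_comm, sub_self]

/-- `𝔰𝔲(n)` is closed under conjugation by unitaries. [folklore] -/
theorem conj_mem_suAlgebra {X u : Matrix (Fin n) (Fin n) ℂ} (hX : X ∈ suAlgebra n)
    (hu : u ∈ Matrix.unitaryGroup (Fin n) ℂ) : u * X * uᴴ ∈ suAlgebra n := by
  rw [mem_suAlgebra_iff] at hX ⊢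
  have hu' : uᴴ * u = 1 := Matrix.mem_unitaryGroup_iff'.1 hu
  refine ⟨?_, ?_⟩
  · rw [conjTranspose_mul, conjTranspose_mul, conjTranspose_conjTranspose, hX.1, neg_mul, mul_neg,
      Matrix.mul_assoc]
  · rw [trace_mul_cycle, hu', Matrix.one_mul, hX.2]

/-- Antisymmetry of the real structure constants: `coordL_c [T_a, Y] = -coordL_a [T_c, Y]`. [folklore] -/
theorem coordL_comm_antisymm (Y : Matrix (Fin n) (Fin n) ℂ) (a c : B.ι) :
    coordL B c (B.T a * Y - Y * B.T a) = -coordL B a (B.T c * Y - Y * B.T c) := by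
  simp only [coordL_apply, Matrix.mul_sub, trace_sub, Complex.sub_re]
  rw [Matrix.trace_mul_cycle' (B.T c) Y (B.T a), Matrix.trace_mul_cycle' (B.T a) Y (B.T c)]
  ring

/-- Cyclic symmetry of conjugation coordinates: `coordL_a (uᴴ T_b u) = coordL_b (u T_a uᴴ)`. [folklore] -/
theorem coordL_conj_symm (u : Matrix (Fin n) (Fin n) ℂ) (a b : B.ι) :
    coordL B a (uᴴ * B.T b * u) = coordL B b (u * B.T a * uᴴ) := by
  simp only [coordL_apply]
  rw [Matrix.trace_mul_comm (B.T a), Matrix.trace_mul_cycle' (B.T b)]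
  simp only [Matrix.mul_assoc]

/-- Orthogonality of the conjugation matrix `r_{ab} = coordL_b (u T_a uᴴ)`: `∑ₐ r_{ab} r_{ab'} = δ_{bb'}`
(`Ad_u` is orthogonal for `-2 Re tr`). [folklore] -/
theorem sum_coordL_conj_mul {u : Matrix (Fin n) (Fin n) ℂ} (hu : u ∈ Matrix.unitaryGroup (Fin n) ℂ)
    (b b' : B.ι) :
    ∑ a, coordL B b (u * B.T a * uᴴ) * coordL B b' (u * B.T a * uᴴ) = if b' = b then 1 else 0 := by
  have hu1 : u * uᴴ = 1 := Matrix.mem_unitaryGroup_iff.1 hu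
  have hustar : uᴴ ∈ Matrix.unitaryGroup (Fin n) ℂ := by
    rw [Matrix.mem_unitaryGroup_iff]
    simpa [Matrix.star_eq_conjTranspose] using Matrix.mem_unitaryGroup_iff'.1 hu
  -- `uᴴ T_b u = ∑ₐ r_{ab} T_a`
  have hrev : uᴴ * B.T b * u = ∑ a, coordL B b (u * B.T a * uᴴ) • B.T a := by
    have hmem : uᴴ * B.T b * u ∈ suAlgebra n := by
      simpa [conjTranspose_conjTranspose] using conj_mem_suAlgebra (B.mem b) hustar
    conv_lhs => rw [eq_sum_coordL_smul B hmem]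
    exact Finset.sum_congr rfl fun a _ => by rw [coordL_conj_symm]
  -- `T_b = u (uᴴ T_b u) uᴴ = ∑ₐ r_{ab} (u T_a uᴴ)`; apply `coordL_{b'}`
  have hTb : B.T b = ∑ a, coordL B b (u * B.T a * uᴴ) • (u * B.T a * uᴴ) := by
    calc B.T b = u * (uᴴ * B.T b * u) * uᴴ := by
            simp only [← Matrix.mul_assoc, hu1, Matrix.one_mul]
            rw [Matrix.mul_assoc, hu1, Matrix.mul_one]
      _ = ∑ a, coordL B b (u * B.T a * uᴴ) • (u * B.T a * uᴴ) := by
            rw [hrev, Finset.mul_sum, Finset.sum_mul]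
            exact Finset.sum_congr rfl fun a _ => by rw [Matrix.mul_smul, Matrix.smul_mul, Matrix.mul_assoc]
  have key := congrArg (coordL B b') hTb
  rw [coordL_T, map_sum] at key
  rw [key]
  refine Finset.sum_congr rfl fun a _ => ?_
  rw [map_smul, smul_eq_mul]

end Coordinates

variable {σ E : Type*} [Fintype σ] [DecidableEq σ] [DecidableEq E]

section Casimir
/-! ## §2. The slot Casimir of a link: Hermitian, commuting, and central for the generators -/
variable (B : SuBasis n) (lnk : σ → E) (pol : σ → Bool)

/-- The **slot Casimir** of the link `e`: `C^{σ,e} = -∑ₐ T_a^{σ,e} T_a^{σ,e}`. [ours] -/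
def casimirM (e : E) : Matrix (σ → Fin n) (σ → Fin n) ℂ :=
  -∑ a, slotGen lnk pol e (B.T a) * slotGen lnk pol e (B.T a)

/-- `C^{σ,e}` is Hermitian. [folklore] -/
theorem casimirM_conjTranspose (e : E) : (casimirM B lnk pol e)ᴴ = casimirM B lnk pol e := by
  simp only [casimirM, conjTranspose_neg, conjTranspose_sum, conjTranspose_mul,
    slotGen_conjTranspose_of_skew lnk pol e (skew_T B _), neg_mul_neg]

/-- Anything commuting with all `T_a^{σ,e}` commutes with `C^{σ,e}`. [folklore] -/
theorem casimirM_comm_of_forall (e : E) {X : Matrix (σ → Fin n) (σ → Fin n) ℂ}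
    (h : ∀ a, slotGen lnk pol e (B.T a) * X = X * slotGen lnk pol e (B.T a)) :
    casimirM B lnk pol e * X = X * casimirM B lnk pol e := by
  simp only [casimirM, neg_mul, mul_neg, Finset.sum_mul, Finset.mul_sum]
  congr 1
  refine Finset.sum_congr rfl fun a _ => ?_
  rw [mul_assoc, h a, ← mul_assoc, h a, mul_assoc]

/-- (E6a) Slot Casimirs of any two links commute. [ours] -/
theorem casimirM_comm (e e' : E) :
    casimirM B lnk pol e * casimirM B lnk pol e' = casimirM B lnk pol e' * casimirM B lnk pol e := by
  by_cases hee : e = e'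
  · subst hee; rfl
  · refine casimirM_comm_of_forall B lnk pol e fun a => ?_
    exact (casimirM_comm_of_forall B lnk pol e' fun b => slotGen_comm lnk pol (Ne.symm hee) _ _).symm

/-- `slotGen` of zero. [folklore] -/
theorem slotGen_zero (e : E) : slotGen lnk pol e (0 : Matrix (Fin n) (Fin n) ℂ) = 0 := by
  have h := slotGen_smul_real lnk pol e (0 : ℝ) (0 : Matrix (Fin n) (Fin n) ℂ)
  rwa [zero_smul, Complex.ofReal_zero, zero_smul] at h

/-- `slotGen` of a real linear combination. [folklore] -/
theorem slotGen_sum_smul (e : E) {ι : Type*} (s : Finset ι) (r : ι → ℝ)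
    (T : ι → Matrix (Fin n) (Fin n) ℂ) :
    slotGen lnk pol e (∑ i ∈ s, r i • T i) = ∑ i ∈ s, (r i : ℂ) • slotGen lnk pol e (T i) := by
  classical
  induction s using Finset.induction_on with
  | empty => simp [slotGen_zero]
  | insert i s hi ih => rw [Finset.sum_insert hi, Finset.sum_insert hi, slotGen_add, slotGen_smul_real, ih]

/-- (E6b, same link) `C^{σ,e}` commutes with every generator `Y^{σ,e}`, `Y ∈ 𝔰𝔲(n)`: the cross terms
`∑_{a,c} f_{ac} (T_aT_c + T_cT_a)^{σ,e}` cancel by antisymmetry of the structure constants. [folklore] -/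
theorem casimirM_comm_slotGen_same (e : E) {Y : Matrix (Fin n) (Fin n) ℂ} (hY : Y ∈ suAlgebra n) :
    casimirM B lnk pol e * slotGen lnk pol e Y = slotGen lnk pol e Y * casimirM B lnk pol e := by
  set g : B.ι → Matrix (σ → Fin n) (σ → Fin n) ℂ := fun a => slotGen lnk pol e (B.T a) with hg
  set G := slotGen lnk pol e Y with hG
  set r : B.ι → B.ι → ℝ := fun a c => coordL B c (B.T a * Y - Y * B.T a) with hr
  -- the commutators `[g_a, G] = ∑_c r_{ac} g_c`
  have hcomm : ∀ a, g a * G = G * g a + ∑ c, (r a c : ℂ) • g c := by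
    intro a
    have hmem : B.T a * Y - Y * B.T a ∈ suAlgebra n := comm_mem_suAlgebra (B.mem a) hY
    have h1 : g a * G - G * g a = ∑ c, (r a c : ℂ) • g c := by
      simp only [hg, hG, hr]
      rw [slotGen_commutator]
      conv_lhs => rw [eq_sum_coordL_smul B hmem]
      rw [slotGen_sum_smul]
    rw [← h1]; abel
  have hanti : ∀ a c, r a c = -r c a := fun a c => coordL_comm_antisymm B Y a c
  -- the symmetric cross term vanishes
  have hS : ∑ a, ∑ c, (r a c : ℂ) • (g a * g c + g c * g a) = 0 := by
    have h1 : ∑ a, ∑ c, (r a c : ℂ) • (g a * g c + g c * g a)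
        = -∑ a, ∑ c, (r a c : ℂ) • (g a * g c + g c * g a) := by
      conv_lhs => rw [Finset.sum_comm]
      rw [← Finset.sum_neg_distrib]
      refine Finset.sum_congr rfl fun c _ => ?_
      rw [← Finset.sum_neg_distrib]
      refine Finset.sum_congr rfl fun a _ => ?_
      rw [hanti a c, Complex.ofReal_neg, neg_smul, add_comm]
    have h2 : (2 : ℂ) • ∑ a, ∑ c, (r a c : ℂ) • (g a * g c + g c * g a) = 0 := by
      rw [two_smul]
      nth_rewrite 2 [h1]
      exact add_neg_cancel _
    exact (smul_eq_zero.1 h2).resolve_left two_ne_zero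
  -- expand `C G` through the commutators
  have key : ∀ a, g a * g a * G
      = G * (g a * g a) + (g a * ∑ c, (r a c : ℂ) • g c + (∑ c, (r a c : ℂ) • g c) * g a) := by
    intro a
    calc g a * g a * G = g a * (g a * G) := mul_assoc _ _ _
      _ = g a * (G * g a) + g a * ∑ c, (r a c : ℂ) • g c := by rw [hcomm a, mul_add]
      _ = (g a * G) * g a + g a * ∑ c, (r a c : ℂ) • g c := by rw [mul_assoc]
      _ = (G * g a + ∑ c, (r a c : ℂ) • g c) * g a + g a * ∑ c, (r a c : ℂ) • g c := by rw [hcomm a]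
      _ = G * (g a * g a) + (g a * ∑ c, (r a c : ℂ) • g c + (∑ c, (r a c : ℂ) • g c) * g a) := by
            noncomm_ring
  have hcross : ∑ a, (g a * ∑ c, (r a c : ℂ) • g c + (∑ c, (r a c : ℂ) • g c) * g a)
      = ∑ a, ∑ c, (r a c : ℂ) • (g a * g c + g c * g a) := by
    refine Finset.sum_congr rfl fun a _ => ?_
    rw [Finset.mul_sum, Finset.sum_mul, ← Finset.sum_add_distrib]
    refine Finset.sum_congr rfl fun c _ => ?_
    rw [Matrix.mul_smul, Matrix.smul_mul, smul_add]
  show casimirM B lnk pol e * G = G * casimirM B lnk pol e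
  simp only [casimirM, neg_mul, mul_neg, Finset.sum_mul, Finset.mul_sum]
  congr 1
  calc ∑ a, g a * g a * G
      = ∑ a, (G * (g a * g a) + (g a * ∑ c, (r a c : ℂ) • g c + (∑ c, (r a c : ℂ) • g c) * g a)) :=
        Finset.sum_congr rfl fun a _ => key a
    _ = ∑ a, G * (g a * g a) + ∑ a, ∑ c, (r a c : ℂ) • (g a * g c + g c * g a) := by
        rw [Finset.sum_add_distrib, hcross]
    _ = ∑ a, G * (g a * g a) := by rw [hS, add_zero]

/-- (E6b) `C^{σ,e}` commutes with every slot generator `Y^{σ,e'}`, `Y ∈ 𝔰𝔲(n)`. [ours] -/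
theorem casimirM_comm_slotGen (e e' : E) {Y : Matrix (Fin n) (Fin n) ℂ} (hY : Y ∈ suAlgebra n) :
    casimirM B lnk pol e * slotGen lnk pol e' Y = slotGen lnk pol e' Y * casimirM B lnk pol e := by
  by_cases hee : e = e'
  · subst hee; exact casimirM_comm_slotGen_same B lnk pol e hY
  · exact casimirM_comm_of_forall B lnk pol e fun a => slotGen_comm lnk pol hee _ _

end Casimir

section Covariance
/-! ## §3. Conjugation by `R_σ(U)` and commutation of `C^{σ,e}` with the representation -/
variable (B : SuBasis n) (lnk : σ → E) (pol : σ → Bool)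

/-- `⊗ₛ' A s' * ins s Z = ⊗ (A with A s·Z at slot s)`. [folklore] -/
theorem kronPi_mul_ins (A : σ → Matrix (Fin n) (Fin n) ℂ) (s : σ) (Z : Matrix (Fin n) (Fin n) ℂ) :
    kronPi A * ins s Z = kronPi (Function.update A s (A s * Z)) := by
  rw [ins, ← kronPi_mul]
  refine kronPi_congr fun s' => ?_
  rcases eq_or_ne s' s with rfl | h
  · simp
  · simp [Function.update_of_ne h]

omit [DecidableEq E] in
/-- Conjugating an insertion by `R_σ(U)`, `U` unitary: `R ins_s(Z) Rᴴ = ins_s(Û_s Z Û_sᴴ)`. [folklore] -/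
theorem slotRep_mul_ins_mul_conjTranspose (U : E → Matrix (Fin n) (Fin n) ℂ)
    (hU : ∀ e, U e ∈ Matrix.unitaryGroup (Fin n) ℂ) (s : σ) (Z : Matrix (Fin n) (Fin n) ℂ) :
    slotRep lnk pol U * ins s Z * (slotRep lnk pol U)ᴴ =
      ins s (polM (pol s) (U (lnk s)) * Z * (polM (pol s) (U (lnk s)))ᴴ) := by
  have hunit : ∀ s', polM (pol s') (U (lnk s')) * (polM (pol s') (U (lnk s')))ᴴ = 1 := fun s' =>
    Matrix.mem_unitaryGroup_iff.1 (polM_mem_unitaryGroup (pol s') (hU (lnk s')))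
  rw [slotRep, kronPi_mul_ins, kronPi_conjTranspose, ← kronPi_mul, ins]
  refine kronPi_congr fun s' => ?_
  rcases eq_or_ne s' s with rfl | h
  · simp only [Function.update_self]
  · simp only [Function.update_of_ne h, hunit]

/-- **Conjugation formula** `R_σ(U) Y^{σ,e} R_σ(U)ᴴ = (U_e Y U_eᴴ)^{σ,e}` for unitary `U`. [ours] -/
theorem conj_slotGen (U : E → Matrix (Fin n) (Fin n) ℂ) (hU : ∀ e, U e ∈ Matrix.unitaryGroup (Fin n) ℂ)
    (e : E) (Y : Matrix (Fin n) (Fin n) ℂ) :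
    slotRep lnk pol U * slotGen lnk pol e Y * (slotRep lnk pol U)ᴴ = slotGen lnk pol e (U e * Y * (U e)ᴴ) := by
  simp only [slotGen, Finset.mul_sum, Finset.sum_mul, mul_ite, ite_mul, mul_zero, zero_mul]
  refine Finset.sum_congr rfl fun s _ => ?_
  split_ifs with hs
  · rw [slotRep_mul_ins_mul_conjTranspose lnk pol U hU, hs, polM_mul, polM_mul, polM_conjTranspose]
  · rfl

/-- Basis independence of `∑ₐ xₐ xₐ` under an orthogonal change of coefficients. [folklore] -/
theorem sum_expand_mul_expand {ι A : Type*} [Fintype ι] [DecidableEq ι] [Ring A] [Module ℂ A]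
    [IsScalarTower ℂ A A] [SMulCommClass ℂ A A] (r : ι → ι → ℝ)
    (hr : ∀ b b', ∑ a, r a b * r a b' = if b' = b then 1 else 0) (x : ι → A) :
    ∑ a, (∑ b, (r a b : ℂ) • x b) * (∑ b', (r a b' : ℂ) • x b') = ∑ b, x b * x b := by
  have hrC : ∀ b b', ∑ a, (r a b : ℂ) * (r a b' : ℂ) = if b' = b then (1 : ℂ) else 0 := by
    intro b b'
    rw [show (∑ a, (r a b : ℂ) * (r a b' : ℂ)) = ((∑ a, r a b * r a b' : ℝ) : ℂ) by push_cast; rfl,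
      hr b b']
    split_ifs <;> simp
  calc ∑ a, (∑ b, (r a b : ℂ) • x b) * (∑ b', (r a b' : ℂ) • x b')
      = ∑ a, ∑ b, ∑ b', ((r a b : ℂ) * (r a b' : ℂ)) • (x b * x b') := by
        refine Finset.sum_congr rfl fun a _ => ?_
        rw [Finset.sum_mul_sum]
        exact Finset.sum_congr rfl fun b _ => Finset.sum_congr rfl fun b' _ => smul_mul_smul_comm _ _ _ _
    _ = ∑ b, ∑ b', (∑ a, (r a b : ℂ) * (r a b' : ℂ)) • (x b * x b') := by
        rw [Finset.sum_comm]
        refine Finset.sum_congr rfl fun b _ => ?_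
        rw [Finset.sum_comm]
        exact Finset.sum_congr rfl fun b' _ => (Finset.sum_smul).symm
    _ = ∑ b, x b * x b := by
        refine Finset.sum_congr rfl fun b _ => ?_
        simp only [hrC, ite_smul, one_smul, zero_smul, Finset.sum_ite_eq', Finset.mem_univ, if_true]

/-- `Ad`-invariance of the Casimir: `∑ₐ ((U T_a Uᴴ)^{σ,e})² = ∑ₐ (T_a^{σ,e})²` for unitary `U`. [folklore] -/
theorem sum_slotGen_conj_mul_self {u : Matrix (Fin n) (Fin n) ℂ} (hu : u ∈ Matrix.unitaryGroup (Fin n) ℂ)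
    (e : E) :
    ∑ a, slotGen lnk pol e (u * B.T a * uᴴ) * slotGen lnk pol e (u * B.T a * uᴴ) =
      ∑ a, slotGen lnk pol e (B.T a) * slotGen lnk pol e (B.T a) := by
  have hexp : ∀ a, slotGen lnk pol e (u * B.T a * uᴴ) =
      ∑ b, (coordL B b (u * B.T a * uᴴ) : ℂ) • slotGen lnk pol e (B.T b) := by
    intro a
    conv_lhs => rw [eq_sum_coordL_smul B (conj_mem_suAlgebra (B.mem a) hu)]
    rw [slotGen_sum_smul]
  simp_rw [hexp]
  exact sum_expand_mul_expand (fun a b => coordL B b (u * B.T a * uᴴ)) (sum_coordL_conj_mul B hu)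
    fun b => slotGen lnk pol e (B.T b)

/-- (E6c) **The slot Casimir commutes with the representation**: `C^{σ,e} R_σ(U) = R_σ(U) C^{σ,e}` for every
unitary configuration `U` (hence on `SU(n)^E`). [ours] -/
theorem casimirM_comm_slotRep (U : E → Matrix (Fin n) (Fin n) ℂ)
    (hU : ∀ e, U e ∈ Matrix.unitaryGroup (Fin n) ℂ) (e : E) :
    casimirM B lnk pol e * slotRep lnk pol U = slotRep lnk pol U * casimirM B lnk pol e := by
  set R := slotRep lnk pol U with hR
  have hRR : Rᴴ * R = 1 := Matrix.mem_unitaryGroup_iff'.1 (slotRep_mem_unitaryGroup lnk pol hU)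
  have hconj : R * casimirM B lnk pol e * Rᴴ = casimirM B lnk pol e := by
    simp only [casimirM, mul_neg, neg_mul, Finset.mul_sum, Finset.sum_mul]
    congr 1
    calc ∑ a, R * (slotGen lnk pol e (B.T a) * slotGen lnk pol e (B.T a)) * Rᴴ
        = ∑ a, (R * slotGen lnk pol e (B.T a) * Rᴴ) * (R * slotGen lnk pol e (B.T a) * Rᴴ) := by
          refine Finset.sum_congr rfl fun a _ => ?_
          calc R * (slotGen lnk pol e (B.T a) * slotGen lnk pol e (B.T a)) * Rᴴ
              = R * slotGen lnk pol e (B.T a) * (Rᴴ * R) * slotGen lnk pol e (B.T a) * Rᴴ := by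
                rw [hRR]; noncomm_ring
            _ = (R * slotGen lnk pol e (B.T a) * Rᴴ) * (R * slotGen lnk pol e (B.T a) * Rᴴ) := by
                noncomm_ring
      _ = ∑ a, slotGen lnk pol e (U e * B.T a * (U e)ᴴ) * slotGen lnk pol e (U e * B.T a * (U e)ᴴ) := by
          refine Finset.sum_congr rfl fun a _ => ?_
          rw [hR, conj_slotGen lnk pol U hU]
      _ = ∑ a, slotGen lnk pol e (B.T a) * slotGen lnk pol e (B.T a) := sum_slotGen_conj_mul_self B lnk pol (hU e) e
  calc casimirM B lnk pol e * R = R * casimirM B lnk pol e * Rᴴ * R := by rw [hconj]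
    _ = R * casimirM B lnk pol e * (Rᴴ * R) := by simp only [mul_assoc]
    _ = R * casimirM B lnk pol e := by rw [hRR, mul_one]

end Covariance

end Summit.Ventures.LatticeQCDFlow.TrivializingMaps.SlotCasimir
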